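import Mathlib
import Summits.Ventures.PercRepro2.TB14SlideKernels
import Summits.Ventures.PercRepro2.TB14Deg2Mark

/-!
# A degree-two mark between two non-avoided vertices: the three-term identity for typed BHK 1.3
(blind cell PercRepro2, mine-c g18, 2026-08-25; `proofs/MINEC-TB14BLOCK.md` §12.6, Theorem N′)

The typed BHK 1.3 kernel `foldK13 = 1_Q(y) 1_Q(w) 1[x ∈ C_y(a₂)] (1[o ∈ C_y(a₂)] − 1[o ∈ C_w(a₂)])`
(root `a₂`, avoided root `a₁`, events `{x ∈ C₂}`, `{o ∈ C₂}`).  Let the mark `o` have exactly two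
edges `e₁ = o u`, `e₂ = o v`, both free.  Split the two-copy sum on the colours of `(e₁, e₂)` in the
first copy `y`:
* `e₁` open, `e₂` closed: `o` is a leaf at `u` in `y` and a leaf at `v` in `w`, so
  `1[o ∈ C_y(a₂)] = 1[u ∈ C_{y₂}(a₂)]` and `1[o ∈ C_w(a₂)] = 1[v ∈ C_{w₂}(a₂)]`; symmetrically for
  `e₂` open, `e₁` closed.  The two mixed patterns add up to the kernels of the marks `u` and `v`.
* both open in `y`: the path `u – o – v` is the edge `u v` of the rerouted graph `ends[e₁ ↦ s(u, v)]`
  with `e₁` open in the first copy only, `o` is isolated in `w` — the RED star at the virtual mark;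
* both closed in `y` (both open in `w`): the mirror image, with the sign `−` — the BLUE star.
Hence (`pairCount_foldK13_deg2mark`)

  `S₁₃(G; x, o) = S₁₃(G − o; x, u) + S₁₃(G − o; x, v) + T₁₃(G − o; x, {u, v})`,

with `T₁₃` the two-copy count of `foldK13Star` = (red star) − (blue star).  Exact check
`data/mine-c/g18/scripts/tb13deg2.c` (every avoid set; n ≤ 7, 0 failures).  Own work; standard axioms.
-/

namespace Summit.Ventures.PercRepro2

namespace TB14Cut

open CovForm A3InactiveTyped

section Deg2Mark13

variable {V : Type} {E : Type} [Fintype E] [DecidableEq E] {R : Type*} [Field R]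
variable {ends : E → Sym2 V} {e₁ e₂ : E} {o u v a₁ a₂ x : V}

/-- The star kernel of Theorem N′ at the profile with `e₁, e₂` closed: on the rerouted graph
`ends' = ends[e₁ ↦ s(u, v)]`, (red star) `1_Q(y₂[e₁ ↦ 1]) 1_Q(w₂) 1[x ∈ C(a₂)] 1[u ∈ C(a₂)]` (both
clusters in the first copy with the edge open) minus (blue star)
`1_Q(y₂) 1_Q(w₂[e₁ ↦ 1]) 1[x ∈ C_{y₂}(a₂)] 1[u ∈ C_{w₂[e₁ ↦ 1]}(a₂)]`. -/
noncomputable def foldK13Star (ends : E → Sym2 V) (e₁ : E) (a₁ a₂ x u v : V) :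
    Config E → Config E → R :=
  fun y₂ w₂ =>
    iQ (Function.update ends e₁ s(u, v)) a₁ a₂ (Function.update y₂ e₁ true) *
        iQ (Function.update ends e₁ s(u, v)) a₁ a₂ w₂ *
        iH (Function.update ends e₁ s(u, v)) a₂ x (Function.update y₂ e₁ true) *
        iH (Function.update ends e₁ s(u, v)) a₂ u (Function.update y₂ e₁ true) -
      iQ (Function.update ends e₁ s(u, v)) a₁ a₂ y₂ *
        iQ (Function.update ends e₁ s(u, v)) a₁ a₂ (Function.update w₂ e₁ true) *
        iH (Function.update ends e₁ s(u, v)) a₂ x y₂ *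
        iH (Function.update ends e₁ s(u, v)) a₂ u (Function.update w₂ e₁ true)

/-- **The degree-two mark identity for typed BHK 1.3** (THEOREM N′): if the mark `o` of the kernel
`foldK13 ends a₁ a₂ x o` has exactly the two free edges `e₁ = o u` and `e₂ = o v`, then
`S₁₃(G; x, o) = S₁₃(G − o; x, u) + S₁₃(G − o; x, v) + T₁₃`, the last term being the two-copy count of
`foldK13Star` at the profile with both edges closed. -/
theorem pairCount_foldK13_deg2mark (he : e₁ ≠ e₂) (h₁ : ends e₁ = s(o, u)) (h₂ : ends e₂ = s(o, v))
    (hou : o ≠ u) (hov : o ≠ v) (ho : ∀ f, o ∈ ends f → f = e₁ ∨ f = e₂)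
    (ha₁ : a₁ ≠ o) (ha₂ : a₂ ≠ o) (hx : x ≠ o) (F : Finset E) (z : Config E) (h₁F : e₁ ∈ F)
    (h₂F : e₂ ∈ F) :
    pairCount F z (foldK13 ends a₁ a₂ x o : Config E → Config E → R) =
      pairCount ((F.erase e₂).erase e₁) (Function.update (Function.update z e₂ false) e₁ false)
          (foldK13 ends a₁ a₂ x u) +
        pairCount ((F.erase e₂).erase e₁) (Function.update (Function.update z e₂ false) e₁ false)
          (foldK13 ends a₁ a₂ x v) +
        pairCount ((F.erase e₂).erase e₁) (Function.update (Function.update z e₂ false) e₁ false)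
          (foldK13Star ends e₁ a₁ a₂ x u v) := by
  classical
  set ends' := Function.update ends e₁ s(u, v) with hends'
  set F' := F.erase e₂ with hF'
  set z' := Function.update z e₂ false with hz'
  set F'' := F'.erase e₁ with hF''
  set z'' := Function.update z' e₁ false with hz''
  have h₁F' : e₁ ∈ F' := Finset.mem_erase.2 ⟨he, h₁F⟩
  have ho₁ : ∀ f, o ∈ ends f → f ≠ e₁ → f = e₂ := fun f hf hf₁ => (ho f hf).resolve_left hf₁
  have ho₂ : ∀ f, o ∈ ends f → f ≠ e₂ → f = e₁ := fun f hf hf₂ => (ho f hf).resolve_right hf₂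
  have hends'_ne : ∀ f, f ≠ e₁ → ends' f = ends f := fun f hf => by
    rw [hends', Function.update_of_ne hf]
  have hw''₁ : ∀ y₂ : Config E, y₂ e₁ = false → A3InactiveTyped.flipOn F'' y₂ e₁ = false := by
    intro y₂ hy₂₁
    rw [A3InactiveTyped.flipOn_of_notMem (Finset.notMem_erase e₁ F')]; exact hy₂₁
  have hw''₂ : ∀ y₂ : Config E, y₂ e₂ = false → A3InactiveTyped.flipOn F'' y₂ e₂ = false := by
    intro y₂ hy₂₂
    rw [A3InactiveTyped.flipOn_of_notMem (fun h => Finset.notMem_erase e₂ F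
      (Finset.mem_of_mem_erase h))]
    exact hy₂₂
  -- (C) `e₁` open, `e₂` closed in the first copy
  have hC : ∀ y₂ : Config E, y₂ e₁ = false → y₂ e₂ = false →
      (foldK13 ends a₁ a₂ x o (Function.update y₂ e₁ true)
          (A3InactiveTyped.flipOn F (Function.update y₂ e₁ true)) : R) =
        iQ ends a₁ a₂ y₂ * iQ ends a₁ a₂ (A3InactiveTyped.flipOn F'' y₂) * iH ends a₂ x y₂ *
          (iH ends a₂ u y₂ - iH ends a₂ v (A3InactiveTyped.flipOn F'' y₂)) := by
    intro y₂ hy₂₁ hy₂₂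
    set y := Function.update y₂ e₁ true with hy
    set w := A3InactiveTyped.flipOn F y with hw
    have hy₁ : y e₁ = true := Function.update_self _ _ _
    have hy₂ : y e₂ = false := by rw [hy, Function.update_of_ne he.symm]; exact hy₂₂
    have hyback : Function.update y e₁ false = y₂ := by
      rw [hy, Function.update_idem, ← hy₂₁]; exact Function.update_eq_self e₁ y₂
    have hleafy : ∀ f, o ∈ ends f → f ≠ e₁ → y f = false := by
      intro f hf hf₁
      rw [ho₁ f hf hf₁]; exact hy₂
    have hw₁ : w e₁ = false := by
      rw [hw, A3InactiveTyped.flipOn_of_mem h₁F, hy₁]; rfl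
    have hw₂ : w e₂ = true := by
      rw [hw, A3InactiveTyped.flipOn_of_mem h₂F, hy₂]; rfl
    have hleafw : ∀ f, o ∈ ends f → f ≠ e₂ → w f = false := by
      intro f hf hf₂
      rw [ho₂ f hf hf₂]; exact hw₁
    have hwback : Function.update w e₂ false = A3InactiveTyped.flipOn F'' y₂ := by
      funext f
      by_cases hf₂ : f = e₂
      · subst hf₂
        rw [Function.update_self,
          A3InactiveTyped.flipOn_of_notMem (fun h => Finset.notMem_erase f F
            (Finset.mem_of_mem_erase h))]
        exact hy₂₂.symm
      by_cases hf₁ : f = e₁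
      · subst hf₁
        rw [Function.update_of_ne hf₂, hw₁,
          A3InactiveTyped.flipOn_of_notMem (Finset.notMem_erase f F')]
        exact hy₂₁.symm
      · rw [Function.update_of_ne hf₂, hw]
        by_cases hfF : f ∈ F
        · rw [A3InactiveTyped.flipOn_of_mem hfF,
            A3InactiveTyped.flipOn_of_mem (Finset.mem_erase.2 ⟨hf₁, Finset.mem_erase.2 ⟨hf₂, hfF⟩⟩),
            hy, Function.update_of_ne hf₁]
        · rw [A3InactiveTyped.flipOn_of_notMem hfF,
            A3InactiveTyped.flipOn_of_notMem (fun h => hfF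
              (Finset.mem_of_mem_erase (Finset.mem_of_mem_erase h))), hy,
            Function.update_of_ne hf₁]
    have hQy : Conn ends y a₁ a₂ ↔ Conn ends y₂ a₁ a₂ := by
      rw [conn_leaf_erase h₁ hou hleafy hy₁ ha₁ ha₂, hyback]
    have hQw : Conn ends w a₁ a₂ ↔ Conn ends (A3InactiveTyped.flipOn F'' y₂) a₁ a₂ := by
      rw [conn_leaf_erase h₂ hov hleafw hw₂ ha₁ ha₂, hwback]
    have hxy : Conn ends y a₂ x ↔ Conn ends y₂ a₂ x := by
      rw [conn_leaf_erase h₁ hou hleafy hy₁ ha₂ hx, hyback]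
    have hoy : Conn ends y a₂ o ↔ Conn ends y₂ a₂ u := by
      rw [conn_mark_leaf h₁ hou hleafy hy₁ ha₂, hyback]
    have how : Conn ends w a₂ o ↔ Conn ends (A3InactiveTyped.flipOn F'' y₂) a₂ v := by
      rw [conn_mark_leaf h₂ hov hleafw hw₂ ha₂, hwback]
    simp only [foldK13, iQ_eq_ite', iH_eq_ite', hQy, hQw, hxy, hoy, how]
  -- (B) `e₂` open, `e₁` closed in the first copy
  have hB : ∀ y₂ : Config E, y₂ e₁ = false → y₂ e₂ = false →
      (foldK13 ends a₁ a₂ x o (Function.update y₂ e₂ true)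
          (A3InactiveTyped.flipOn F (Function.update y₂ e₂ true)) : R) =
        iQ ends a₁ a₂ y₂ * iQ ends a₁ a₂ (A3InactiveTyped.flipOn F'' y₂) * iH ends a₂ x y₂ *
          (iH ends a₂ v y₂ - iH ends a₂ u (A3InactiveTyped.flipOn F'' y₂)) := by
    intro y₂ hy₂₁ hy₂₂
    set y := Function.update y₂ e₂ true with hy
    set w := A3InactiveTyped.flipOn F y with hw
    have hy₂ : y e₂ = true := Function.update_self _ _ _
    have hy₁ : y e₁ = false := by rw [hy, Function.update_of_ne he]; exact hy₂₁
    have hyback : Function.update y e₂ false = y₂ := by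
      rw [hy, Function.update_idem, ← hy₂₂]; exact Function.update_eq_self e₂ y₂
    have hleafy : ∀ f, o ∈ ends f → f ≠ e₂ → y f = false := by
      intro f hf hf₂
      rw [ho₂ f hf hf₂]; exact hy₁
    have hw₂ : w e₂ = false := by
      rw [hw, A3InactiveTyped.flipOn_of_mem h₂F, hy₂]; rfl
    have hw₁ : w e₁ = true := by
      rw [hw, A3InactiveTyped.flipOn_of_mem h₁F, hy₁]; rfl
    have hleafw : ∀ f, o ∈ ends f → f ≠ e₁ → w f = false := by
      intro f hf hf₁
      rw [ho₁ f hf hf₁]; exact hw₂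
    have hwback : Function.update w e₁ false = A3InactiveTyped.flipOn F'' y₂ := by
      funext f
      by_cases hf₁ : f = e₁
      · subst hf₁
        rw [Function.update_self, A3InactiveTyped.flipOn_of_notMem (Finset.notMem_erase f F')]
        exact hy₂₁.symm
      by_cases hf₂ : f = e₂
      · subst hf₂
        rw [Function.update_of_ne hf₁, hw₂,
          A3InactiveTyped.flipOn_of_notMem (fun h => Finset.notMem_erase f F
            (Finset.mem_of_mem_erase h))]
        exact hy₂₂.symm
      · rw [Function.update_of_ne hf₁, hw]
        by_cases hfF : f ∈ F
        · rw [A3InactiveTyped.flipOn_of_mem hfF,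
            A3InactiveTyped.flipOn_of_mem (Finset.mem_erase.2 ⟨hf₁, Finset.mem_erase.2 ⟨hf₂, hfF⟩⟩),
            hy, Function.update_of_ne hf₂]
        · rw [A3InactiveTyped.flipOn_of_notMem hfF,
            A3InactiveTyped.flipOn_of_notMem (fun h => hfF
              (Finset.mem_of_mem_erase (Finset.mem_of_mem_erase h))), hy,
            Function.update_of_ne hf₂]
    have hQy : Conn ends y a₁ a₂ ↔ Conn ends y₂ a₁ a₂ := by
      rw [conn_leaf_erase h₂ hov hleafy hy₂ ha₁ ha₂, hyback]
    have hQw : Conn ends w a₁ a₂ ↔ Conn ends (A3InactiveTyped.flipOn F'' y₂) a₁ a₂ := by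
      rw [conn_leaf_erase h₁ hou hleafw hw₁ ha₁ ha₂, hwback]
    have hxy : Conn ends y a₂ x ↔ Conn ends y₂ a₂ x := by
      rw [conn_leaf_erase h₂ hov hleafy hy₂ ha₂ hx, hyback]
    have hoy : Conn ends y a₂ o ↔ Conn ends y₂ a₂ v := by
      rw [conn_mark_leaf h₂ hov hleafy hy₂ ha₂, hyback]
    have how : Conn ends w a₂ o ↔ Conn ends (A3InactiveTyped.flipOn F'' y₂) a₂ u := by
      rw [conn_mark_leaf h₁ hou hleafw hw₁ ha₂, hwback]
    simp only [foldK13, iQ_eq_ite', iH_eq_ite', hQy, hQw, hxy, hoy, how]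
  -- (D) both open in the first copy: the red star
  have hD : ∀ y₂ : Config E, y₂ e₁ = false → y₂ e₂ = false →
      (foldK13 ends a₁ a₂ x o (Function.update (Function.update y₂ e₁ true) e₂ true)
          (A3InactiveTyped.flipOn F (Function.update (Function.update y₂ e₁ true) e₂ true)) : R) =
        iQ ends' a₁ a₂ (Function.update y₂ e₁ true) * iQ ends' a₁ a₂ (A3InactiveTyped.flipOn F'' y₂) *
          iH ends' a₂ x (Function.update y₂ e₁ true) * iH ends' a₂ u (Function.update y₂ e₁ true) := by
    intro y₂ hy₂₁ hy₂₂
    set y := Function.update (Function.update y₂ e₁ true) e₂ true with hy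
    have hy₁ : y e₁ = true := by
      rw [hy, Function.update_of_ne he, Function.update_self]
    have hy₂ : y e₂ = true := Function.update_self _ _ _
    have hyback : Function.update y e₂ false = Function.update y₂ e₁ true := by
      rw [hy, Function.update_idem]
      have : Function.update y₂ e₁ true e₂ = false := by
        rw [Function.update_of_ne he.symm]; exact hy₂₂
      rw [← this]; exact Function.update_eq_self e₂ _
    have hw : A3InactiveTyped.flipOn F y = A3InactiveTyped.flipOn F'' y₂ :=
      flipOn_both_open he F h₁F h₂F y₂ hy₂₁ hy₂₂
    have hw₁ := hw''₁ y₂ hy₂₁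
    have hw₂ := hw''₂ y₂ hy₂₂
    rw [hw]
    have hser : ∀ t t' : V, t ≠ o → t' ≠ o →
        (Conn ends y t t' ↔ Conn ends' (Function.update y₂ e₁ true) t t') := by
      intro t t' ht ht'
      rw [conn_series he h₁ h₂ hou hov ho hy₁ hy₂ ht ht', hyback]
    have hQy := hser a₁ a₂ ha₁ ha₂
    have hxy := hser a₂ x ha₂ hx
    have hadj : Conn ends y o u := conn_of_openAdj ⟨e₁, hy₁, h₁⟩
    have hoy : Conn ends y a₂ o ↔ Conn ends' (Function.update y₂ e₁ true) a₂ u := by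
      rw [← hser a₂ u ha₂ hou.symm]
      exact ⟨fun h => conn_trans h hadj, fun h => conn_trans h (conn_symm hadj)⟩
    have hQw : Conn ends (A3InactiveTyped.flipOn F'' y₂) a₁ a₂ ↔
        Conn ends' (A3InactiveTyped.flipOn F'' y₂) a₁ a₂ :=
      conn_closed_pair (e₂ := e₂) hends'_ne hw₁ hw₂ hw₁ hw₂ (fun _ _ _ => rfl) a₁ a₂
    have hiso : ∀ f, o ∈ ends f → A3InactiveTyped.flipOn F'' y₂ f = false := by
      intro f hf
      rcases ho f hf with rfl | rfl
      · exact hw₁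
      · exact hw₂
    have how : Conn ends (A3InactiveTyped.flipOn F'' y₂) a₂ o ↔ False :=
      iff_false_intro (not_conn_isolated hiso ha₂)
    simp only [foldK13, iQ_eq_ite', iH_eq_ite', hQy, hQw, hxy, hoy, how, if_false]
    ring
  -- (A) both closed in the first copy (both open in the second): the blue star
  have hA : ∀ y₂ : Config E, y₂ e₁ = false → y₂ e₂ = false →
      (foldK13 ends a₁ a₂ x o y₂ (A3InactiveTyped.flipOn F y₂) : R) =
        - (iQ ends' a₁ a₂ y₂ *
          iQ ends' a₁ a₂ (Function.update (A3InactiveTyped.flipOn F'' y₂) e₁ true) *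
          iH ends' a₂ x y₂ *
          iH ends' a₂ u (Function.update (A3InactiveTyped.flipOn F'' y₂) e₁ true)) := by
    intro y₂ hy₂₁ hy₂₂
    set w₂ := A3InactiveTyped.flipOn F'' y₂ with hw₂def
    have hw₁ := hw''₁ y₂ hy₂₁
    have hw₂ := hw''₂ y₂ hy₂₂
    -- the second copy has both edges open: it is `w₂[e₁ ↦ 1][e₂ ↦ 1]`
    have hwA : A3InactiveTyped.flipOn F y₂ = Function.update (Function.update w₂ e₁ true) e₂ true := by
      funext f
      by_cases hf₂ : f = e₂
      · subst hf₂
        rw [A3InactiveTyped.flipOn_of_mem h₂F, hy₂₂, Function.update_self]; rfl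
      by_cases hf₁ : f = e₁
      · subst hf₁
        rw [A3InactiveTyped.flipOn_of_mem h₁F, hy₂₁, Function.update_of_ne hf₂,
          Function.update_self]; rfl
      · rw [Function.update_of_ne hf₂, Function.update_of_ne hf₁, hw₂def]
        by_cases hfF : f ∈ F
        · rw [A3InactiveTyped.flipOn_of_mem hfF,
            A3InactiveTyped.flipOn_of_mem (Finset.mem_erase.2 ⟨hf₁, Finset.mem_erase.2 ⟨hf₂, hfF⟩⟩)]
        · rw [A3InactiveTyped.flipOn_of_notMem hfF,
            A3InactiveTyped.flipOn_of_notMem (fun h => hfF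
              (Finset.mem_of_mem_erase (Finset.mem_of_mem_erase h)))]
    rw [hwA]
    set wA := Function.update (Function.update w₂ e₁ true) e₂ true with hwAdef
    have hwA₁ : wA e₁ = true := by
      rw [hwAdef, Function.update_of_ne he, Function.update_self]
    have hwA₂ : wA e₂ = true := Function.update_self _ _ _
    have hwAback : Function.update wA e₂ false = Function.update w₂ e₁ true := by
      rw [hwAdef, Function.update_idem]
      have : Function.update w₂ e₁ true e₂ = false := by
        rw [Function.update_of_ne he.symm]; exact hw₂
      rw [← this]; exact Function.update_eq_self e₂ _
    have hser : ∀ t t' : V, t ≠ o → t' ≠ o →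
        (Conn ends wA t t' ↔ Conn ends' (Function.update w₂ e₁ true) t t') := by
      intro t t' ht ht'
      rw [conn_series he h₁ h₂ hou hov ho hwA₁ hwA₂ ht ht', hwAback]
    have hQw := hser a₁ a₂ ha₁ ha₂
    have hadj : Conn ends wA o u := conn_of_openAdj ⟨e₁, hwA₁, h₁⟩
    have how : Conn ends wA a₂ o ↔ Conn ends' (Function.update w₂ e₁ true) a₂ u := by
      rw [← hser a₂ u ha₂ hou.symm]
      exact ⟨fun h => conn_trans h hadj, fun h => conn_trans h (conn_symm hadj)⟩
    have hQy : Conn ends y₂ a₁ a₂ ↔ Conn ends' y₂ a₁ a₂ :=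
      conn_closed_pair (e₂ := e₂) hends'_ne hy₂₁ hy₂₂ hy₂₁ hy₂₂ (fun _ _ _ => rfl) a₁ a₂
    have hxy : Conn ends y₂ a₂ x ↔ Conn ends' y₂ a₂ x :=
      conn_closed_pair (e₂ := e₂) hends'_ne hy₂₁ hy₂₂ hy₂₁ hy₂₂ (fun _ _ _ => rfl) a₂ x
    have hiso : ∀ f, o ∈ ends f → y₂ f = false := by
      intro f hf
      rcases ho f hf with rfl | rfl
      · exact hy₂₁
      · exact hy₂₂
    have hoy : Conn ends y₂ a₂ o ↔ False := iff_false_intro (not_conn_isolated hiso ha₂)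
    simp only [foldK13, iQ_eq_ite', iH_eq_ite', hQy, hQw, hxy, hoy, how, if_false]
    ring
  -- the counting: split on `e₂`, then on `e₁`
  unfold pairCount
  rw [sum_admissible_split h₂F, ← hF', ← hz', sum_admissible_split h₁F', ← hF'', ← hz'',
    ← Finset.sum_add_distrib, ← Finset.sum_add_distrib]
  refine Finset.sum_congr rfl fun y₂ _ => ?_
  by_cases hadm : ∀ f, f ∉ F'' → y₂ f = z'' f
  · rw [if_pos hadm, if_pos hadm, if_pos hadm, if_pos hadm]
    have hy₂₁ : y₂ e₁ = false := by
      have := hadm e₁ (Finset.notMem_erase e₁ F')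
      rwa [hz'', Function.update_self] at this
    have hy₂₂ : y₂ e₂ = false := by
      have := hadm e₂ (fun h => Finset.notMem_erase e₂ F (Finset.mem_of_mem_erase h))
      rwa [hz'', Function.update_of_ne he.symm, hz', Function.update_self] at this
    have hself₁ : Function.update y₂ e₁ false = y₂ := by
      rw [← hy₂₁]; exact Function.update_eq_self e₁ y₂
    have hself₂ : Function.update y₂ e₂ false = y₂ := by
      rw [← hy₂₂]; exact Function.update_eq_self e₂ y₂
    have hself₂' : Function.update (Function.update y₂ e₁ true) e₂ false =
        Function.update y₂ e₁ true := by
      have : Function.update y₂ e₁ true e₂ = false := by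
        rw [Function.update_of_ne he.symm]; exact hy₂₂
      rw [← this]; exact Function.update_eq_self e₂ _
    rw [hself₁, hself₂, hself₂', hA y₂ hy₂₁ hy₂₂, hB y₂ hy₂₁ hy₂₂, hC y₂ hy₂₁ hy₂₂, hD y₂ hy₂₁ hy₂₂]
    simp only [foldK13, foldK13Star]
    ring
  · rw [if_neg hadm, if_neg hadm, if_neg hadm, if_neg hadm]
    ring

end Deg2Mark13

end TB14Cut

end Summit.Ventures.PercRepro2
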